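import Summits.CriticalPhenomena.PercolationContinuityZ3.Theorems.PercNearOneGluingNoHeavyLowerTailSunflowerCappedPendant
import HarnessLib

/-!
# `NoHeavyLowerTail` (crux stmt-CriticalPhenomena-4575), abstract sunflower cubic: T-BERN — the COEFFICIENTWISE (in `t`) form of the
# capped pendant lemma, and the reduction `TBern ⇒ CappedPendant`

Support file (seat `prim-ineq-prove-1` gen 62; `--supports stmt-CriticalPhenomena-4575`).  No `sorry`, no named facts; one definition
(`TBern`, a parametrised `Prop`, conjecture-shaped) used only as a hypothesis.
Memo: run/shared/lean/prim/prim-ineq-prove-1/FINDING-TBERN-prove1-g62.md §3.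

THE OBSERVATION.  The factor of `CappedPendant s t b β V` (`…SunflowerCappedPendant`) is
`st + s(1−t)vv_j + (1−s)t·u_j + (1−s)(1−t)m_j = t·A_j + (1−t)·g_j` with `A_j := s + (1−s)u_j` and `g_j := (1−s)m_j + s·vv_j`, and the
target is `(t·A₀ + (1−t)·a₀)^(n−1)·(t·1 + (1−t)·V)` (`A₀ = s+(1−s)b`, `a₀ = (1−s)b+sβ`) — the same product for the family
{full petal `(1, V, V)`, `n−1` floors `(b, β, b)`}.  Expanding both products in powers of `t` and `1−t`
(`prod_two_coin_eq_sum`: `∏_j (t·a_j + (1−t)c_j) = Σ_k t^k (1−t)^(n−k) · tcoeff k`, `tcoeff k = Σ_{|S|=k} ∏_S a ∏_{Sᶜ} c`), the capped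
pendant lemma follows for EVERY `t ∈ [0,1]` as soon as the coefficients are dominated one by one
(`prod_le_prod_of_tcoeff_le`).  `TBern s b β V` is that coefficientwise statement — it is `t`-free — and `cappedPendant_of_tbern` is the
reduction.  Numerically `TBern` has no violation under random, adversarial and structured search (memo §3), its interior coefficients have
slack ≥ 12 % at the parameter points where `CappedPendant`'s margin is 1e−3, and it fails (already at `n = 2`) if the `vv`-budget or the
link `m ≤ vv` is dropped; the families of `…SunflowerDiagonalClasses` satisfy it by coefficientwise merging (memo §2).
-/

noncomputable section

namespace Summit.CriticalPhenomena.PercolationContinuityZ3.Theorems.SunflowerPartition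

namespace SafeCalc

namespace LinkedCurrency

open Finset

variable {ι : Type*} [DecidableEq ι]

/-- The `k`-th coefficient of `∏_{i ∈ s} (a_i X + c_i)`: `Σ_{S ⊆ s, |S| = k} (∏_{i∈S} a_i)(∏_{i ∈ s∖S} c_i)`. [this work] -/
def tcoeff (s : Finset ι) (a c : ι → ℝ) (k : ℕ) : ℝ :=
  ∑ S ∈ s.powersetCard k, (∏ i ∈ S, a i) * ∏ i ∈ s \ S, c i

/-- `tcoeff` is nonnegative for nonnegative data. [this work] -/
theorem tcoeff_nonneg (s : Finset ι) {a c : ι → ℝ} (ha : ∀ i ∈ s, 0 ≤ a i) (hc : ∀ i ∈ s, 0 ≤ c i) (k : ℕ) :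
    0 ≤ tcoeff s a c k := by
  unfold tcoeff
  refine sum_nonneg fun S hS => mul_nonneg (prod_nonneg fun i hi => ha i ?_) (prod_nonneg fun i hi => hc i (sdiff_subset hi))
  exact (mem_powersetCard.1 hS).1 hi

/-- **The two-coin expansion**: `∏_{i∈s} (t·a_i + (1−t)·c_i) = Σ_{k ≤ |s|} t^k (1−t)^(|s|−k) · tcoeff s a c k`. [this work] -/
theorem prod_two_coin_eq_sum (s : Finset ι) (a c : ι → ℝ) (t : ℝ) :
    ∏ i ∈ s, (t * a i + (1 - t) * c i) =
      ∑ k ∈ range (s.card + 1), t ^ k * (1 - t) ^ (s.card - k) * tcoeff s a c k := by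
  rw [prod_add, powerset_card_disjiUnion, sum_disjiUnion]
  refine sum_congr rfl fun k _ => ?_
  unfold tcoeff
  rw [mul_sum]
  refine sum_congr rfl fun S hS => ?_
  have hSk : S.card = k := (mem_powersetCard.1 hS).2
  have hSs : S ⊆ s := (mem_powersetCard.1 hS).1
  have hcard : (s \ S).card = s.card - k := by rw [card_sdiff_of_subset hSs, hSk]
  rw [prod_mul_distrib, prod_mul_distrib, prod_const, prod_const, hSk, hcard]
  ring

/-- **Coefficient domination gives domination for every `t ∈ [0,1]`.** [this work] -/
theorem prod_le_prod_of_tcoeff_le (s : Finset ι) (a c a' c' : ι → ℝ) {t : ℝ} (ht : 0 ≤ t) (ht1 : t ≤ 1)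
    (h : ∀ k, tcoeff s a c k ≤ tcoeff s a' c' k) :
    ∏ i ∈ s, (t * a i + (1 - t) * c i) ≤ ∏ i ∈ s, (t * a' i + (1 - t) * c' i) := by
  rw [prod_two_coin_eq_sum, prod_two_coin_eq_sum]
  refine sum_le_sum fun k _ => ?_
  have ht' : 0 ≤ 1 - t := sub_nonneg.2 ht1
  exact mul_le_mul_of_nonneg_left (h k) (mul_nonneg (pow_nonneg ht _) (pow_nonneg ht' _))

/-- The `A`-coordinate of the comparison family {full petal at index `0`, floors elsewhere}: `1` resp. `A₀ = s + (1−s)b`. [this work] -/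
def fullFloorA (s b : ℝ) {n : ℕ} (j : Fin n) : ℝ := if (j : ℕ) = 0 then 1 else s + (1 - s) * b

/-- The `g`-coordinate of the comparison family {full petal at index `0`, floors elsewhere}: `V` resp. `a₀ = (1−s)b + sβ`. [this work] -/
def fullFloorG (s b β V : ℝ) {n : ℕ} (j : Fin n) : ℝ := if (j : ℕ) = 0 then V else (1 - s) * b + s * β

/-- The product of the comparison family is the target of the capped pendant lemma:
`∏_j (t·fullFloorA + (1−t)·fullFloorG) = (st + s(1−t)β + (1−s)b)^(n−1)·(t + (1−t)V)`. [this work] -/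
theorem prod_fullFloor (s b β V t : ℝ) (n : ℕ) (hn : 0 < n) :
    ∏ j : Fin n, (t * fullFloorA s b j + (1 - t) * fullFloorG s b β V j) =
      (s * t + s * (1 - t) * β + (1 - s) * b) ^ (n - 1) * (t + (1 - t) * V) := by
  obtain ⟨n', rfl⟩ : ∃ n', n = n' + 1 := ⟨n - 1, by omega⟩
  rw [Fin.prod_univ_succ]
  have h0 : t * fullFloorA s b (0 : Fin (n' + 1)) + (1 - t) * fullFloorG s b β V (0 : Fin (n' + 1)) = t + (1 - t) * V := by
    simp [fullFloorA, fullFloorG]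
  have hsucc : ∀ i : Fin n', t * fullFloorA s b i.succ + (1 - t) * fullFloorG s b β V i.succ =
      s * t + s * (1 - t) * β + (1 - s) * b := by
    intro i
    have hne : ((i.succ : Fin (n' + 1)) : ℕ) ≠ 0 := by simp [Fin.val_succ]
    simp only [fullFloorA, fullFloorG, hne, if_false]
    ring
  rw [h0, prod_congr rfl fun i _ => hsucc i, prod_const, card_univ, Fintype.card_fin]
  simp only [Nat.add_sub_cancel]
  ring

/-- **T-BERN (statement).**  For every `n` and every family `(u_j, vv_j, m_j)` satisfying the hypotheses of
`CappedPendant s t b β V` (`b ≤ u_j ≤ 1`, `β ≤ vv_j ≤ V`, `b ≤ m_j ≤ min(u_j, vv_j)`, budgets `∏u ≤ b^(n−1)`, `∏vv ≤ β^(n−1)V`,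
`∏((1−s)m + s vv) ≤ a₀^(n−1)V`), the coefficients of `∏_j ((s + (1−s)u_j)X + (1−s)m_j + s vv_j)` are dominated, one by one, by those of
`(X + V)·((s+(1−s)b)X + (1−s)b + sβ)^(n−1)` (written as the `tcoeff`s of the comparison family `fullFloorA`, `fullFloorG`).
It is `t`-free and implies `CappedPendant s t b β V` for every `t ∈ [0,1]` (`cappedPendant_of_tbern`).  Open (memo §3–§5).
[conjecture-shaped hypothesis, this work] -/
def TBern (s b β V : ℝ) : Prop :=
  ∀ (n : ℕ) (u vv m : Fin n → ℝ), (∀ j, b ≤ u j) → (∀ j, u j ≤ 1) → (∀ j, β ≤ vv j) → (∀ j, vv j ≤ V) →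
    (∀ j, b ≤ m j) → (∀ j, m j ≤ u j) → (∀ j, m j ≤ vv j) →
    ∏ j, u j ≤ b ^ (n - 1) → ∏ j, vv j ≤ β ^ (n - 1) * V →
    ∏ j, ((1 - s) * m j + s * vv j) ≤ ((1 - s) * b + s * β) ^ (n - 1) * V →
    ∀ k, tcoeff (univ : Finset (Fin n)) (fun j => s + (1 - s) * u j) (fun j => (1 - s) * m j + s * vv j) k ≤
      tcoeff (univ : Finset (Fin n)) (fullFloorA s b) (fullFloorG s b β V) k

/-- **`TBern ⇒ CappedPendant`** for every `t ∈ [0,1]` (the `n = 0` instance is settled by the `vv`-budget, which forces `1 ≤ V`).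
[this work] -/
theorem cappedPendant_of_tbern {s b β V : ℝ} (hT : TBern s b β V) {t : ℝ} (ht : 0 ≤ t) (ht1 : t ≤ 1) :
    CappedPendant s t b β V := by
  intro n u vv m hub hu1 hvβ hv1 hmb hmu hmv hpu hpv hpg
  rcases Nat.eq_zero_or_pos n with hn | hn
  · -- `n = 0`: the `vv`-budget forces `1 ≤ V`
    subst hn
    simp only [univ_eq_empty, prod_empty, Nat.zero_sub, pow_zero, one_mul] at hpv ⊢
    nlinarith
  have hcoef := hT n u vv m hub hu1 hvβ hv1 hmb hmu hmv hpu hpv hpg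
  have hfac : ∀ j, s * t + s * (1 - t) * vv j + (1 - s) * t * u j + (1 - s) * (1 - t) * m j =
      t * (s + (1 - s) * u j) + (1 - t) * ((1 - s) * m j + s * vv j) := fun j => by ring
  rw [prod_congr rfl fun j _ => hfac j, ← prod_fullFloor s b β V t n hn]
  exact prod_le_prod_of_tcoeff_le univ _ _ _ _ ht ht1 hcoef

end LinkedCurrency

end SafeCalc

end Summit.CriticalPhenomena.PercolationContinuityZ3.Theorems.SunflowerPartition
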